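import Summits.ValiantsHypothesis.ValiantsHypothesis.Theorems.TwoProducts.RankThreeAffineUnivariate
import Summits.ValiantsHypothesis.ValiantsHypothesis.Theorems.TwoProducts.RankTwoJacobianShiftedSpecials
import Summits.ValiantsHypothesis.ValiantsHypothesis.Theorems.TwoProducts.RankThreeAffineTrinomial

/-!
# Rank three AFFINE, T1-A″ SETTLED: ADDITIVELY SEPARATED outer polynomials `f₀(w₀) + f₁(w₁) + f₂(w₂)` are tame, UNIFORMLY in `f₀, f₁, f₂`

Located CLASS of the OPEN rung 3-AFF (`…Cruxes.TwoProducts.ValIdea35g10.RankThreeAffineLaw`) of the SIDE ladder «table-rank-ladder» of crux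
`stmt-ValiantsHypothesis-5906` (`TwoProducts`): for `t`-sparse carriers `w₀, w₁, w₂ ∈ ℂ[x,y]` and ARBITRARY univariate `f₀, f₁, f₂ ∈ ℂ[X]`,
★★ `separatedAffine_nv_le : nv (f₀(w₀) + f₁(w₁) + f₂(w₂)) ≤ 2·B(t) + 4`, `B(t) = 16t²⁴ + 3t¹² + 4t¹⁰ + 3t⁴ + 10(t² + t) + 6` — NO hypothesis on the `fᵢ` (degree-free).
Priced by val-idea-crit-8 g5 VERDICT #73 (conditions C1–C7; route = val-port-1 g5 bus 2026-08-29T07:21:30Z, re-derived by crit-8).  The monomial case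
`fᵢ = ρᵢ·X^{nᵢ}` (Fermat trinomial, T1-A′) is val-port-4 g4's ✓ `…RankThreeAffineTrinomial` — the located INSTANCE of record; this file is the CLASS and does not restate it
(it IMPORTS it, for the shared bookkeeping lemmas `jac_add_left` / `card_supp_mul_le` / `card_supp_sub_le` — gate rule `dedup.landed`: one statement, one module).

THE CHAIN (`J = jac`, `j_ik = J(w_i,w_k)`, `q(u) = Polynomial.aeval u q`, `J(q(u),v) = q′(u)·J(u,v)` = ✓ `jac_aeval`):
(1) carrier `w₂`, ✓ `Eset_subset_of_axial` (`M = F = 1`): `J(N,w₂) = f₀′(w₀)·j₀₂ + f₁′(w₁)·j₁₂ =: E` (`f₂(w₂)` dies, ✓ `jac_aeval_self`);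
(2) carrier `w₁`, ✓ `Eset_subset_of_shifted` (`G = j₁₂`, `M = F' = 1`): `j₁₂·J(E,w₁) − E·J(j₁₂,w₁) = f₀′(w₀)·S₁ + f₀″(w₀)·S₂ =: R`,
    `S₁ = j₁₂·J(j₀₂,w₁) − j₀₂·J(j₁₂,w₁)` (≤ 2t⁵ terms), `S₂ = j₁₂·j₀₂·j₀₁` (≤ t⁶) — the `f₁′, f₁″` terms cancel (`shift_identity₁`);
(3) carrier `w₀`, ✓ `Eset_subset_of_shifted` AGAIN (`G = S₂`, `F' = f₀′(w₀)`): `S₂·J(R,w₀) − R·J(S₂,w₀) = f₀′(w₀)·(S₂·J(S₁,w₀) − S₁·J(S₂,w₀)) = f₀′(w₀)·T` (≤ 4t¹² terms) —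
    both outer functions are functions OF the carrier, so the `f₀″` term cancels (`shift_identity₂`);
(4) ✓ `Eset_aeval_subset_Xc` / `card_Eset_aeval_le` (`…RankThreeAffineUnivariate`): `f₀′(w₀)` has edge directions only in `Xc σ w₀`.
Branches are PRODUCTS or constants: `j₁₂ = 0` / `j₀₂ = 0` / `S₂ = 0` (✓ `ostrowski` via `card_Eset_mul_le`), constant carriers (two- or one-carrier chains, ✓ `aeval_C_eq`, ✓ `Eset_C`).
Counts: ✓ `card_Xc_le`, ✓ `card_Spec_le`, ✓ `card_SpecShift_le'`, ✓ `card_Eset_le`, ✓ `card_support_jac_le`.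
Also `def SeparatedAffineLaw` (crit-8 C3 verbatim) + ★ `separatedAffineLaw` (`c = 31`), and the rung-currency form `separatedAffine_nv_le_aeval`
(`nv (MvPolynomial.aeval w (f₀(X₀) + f₁(X₁) + f₂(X₂)))`, ✓ `Poly3`).
HONEST LABEL: located CLASS of the OPEN rung 3-AFF; the rung in general (MIXED monomials `X₀^a X₁^b …`) / `TwoProducts` / `PlanarCellBound` / `ResidualLawV25` UNMOVED;
NOT γ; 0 summit distance; VP ≠ VNP is NOT proved here or anywhere in this tree.  `--supports stmt-ValiantsHypothesis-5906 --as helper` (val-port-1 g5; critic of record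
val-idea-crit-8 g5).  No instances, no notation, no named facts. [folklore]
-/

noncomputable section
set_option linter.dupNamespace false

namespace Summit.ValiantsHypothesis.ValiantsHypothesis.Theorems.TwoProducts.RankTwoJacobian

open scoped BigOperators Pointwise Classical
open MvPolynomial

/-! ### §1 Support and edge-set bookkeeping -/

/-- Edge directions of a product, with the zero cases folded in: `|Eset (F·G)| ≤ |Eset F| + |Eset G|` (✓ `ostrowski`). [folklore] -/
theorem card_Eset_mul_le {σ : ℝ} (hσ : σ = 1 ∨ σ = -1) (F G : Poly2) :
    (Eset σ (F * G)).card ≤ (Eset σ F).card + (Eset σ G).card := by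
  by_cases hF : F = 0
  · rw [hF, zero_mul, Eset_zero]; simp
  by_cases hG : G = 0
  · rw [hG, mul_zero, Eset_zero]; simp
  exact (Finset.card_le_card (Eset_mul_subset hσ hF hG)).trans (Finset.card_union_le _ _)

/-- `|Eset σ (J(u,v))| ≤ t⁴` for `t`-sparse `u, v`. [folklore] -/
theorem card_Eset_jac_le (σ : ℝ) {t : ℕ} {u v : Poly2} (hu : u.support.card ≤ t) (hv : v.support.card ≤ t) :
    (Eset σ (jac u v)).card ≤ t ^ 4 := by
  have h := (card_support_jac_le u v).trans (Nat.mul_le_mul hu hv)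
  calc (Eset σ (jac u v)).card ≤ (jac u v).support.card * (jac u v).support.card := card_Eset_le σ _
    _ ≤ (t * t) * (t * t) := Nat.mul_le_mul h h
    _ = t ^ 4 := by ring

/-- A constant carrier has `J(C c, v) = 0`; contrapositive: `J(u,v) ≠ 0 ⇒ u` is non-constant. [folklore] -/
theorem S1_nonempty_of_jac_ne_zero {u v : Poly2} (h : jac u v ≠ 0) : (S1 u).Nonempty := by
  by_contra hS
  exact h (by rw [eq_C_of_S1_empty hS, jac_C_left])

/-! ### §2 The two shifted-Wronskian identities of the chain -/

/-- **Step-2 identity.** If `J(Q,v) = 0` (an outer function of the carrier `v`) and `J(P,v) = P₂·j` (an outer function of another carrier), then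
`G·J(P·A + Q·G, v) − (P·A + Q·G)·J(G,v) = P·(G·J(A,v) − A·J(G,v)) + P₂·(G·A·j)` — the `Q`-terms cancel. [folklore] -/
theorem shift_identity₁ (A G P P₂ Q v j : Poly2) (hQ : jac Q v = 0) (hP : jac P v = P₂ * j) :
    G * jac (P * A + Q * G) v - (P * A + Q * G) * jac G v = P * (G * jac A v - A * jac G v) + P₂ * (G * A * j) := by
  rw [jac_add_left, jac_mul_left, jac_mul_left, hQ, hP]
  ring

/-- **Step-3 identity.** If `J(P,v) = J(P₂,v) = 0` (two outer functions of the carrier `v`), then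
`S₂·J(P·S₁ + P₂·S₂, v) − (P·S₁ + P₂·S₂)·J(S₂,v) = P·(S₂·J(S₁,v) − S₁·J(S₂,v))` — the `P₂`-term cancels. [folklore] -/
theorem shift_identity₂ (P P₂ S₁ S₂ v : Poly2) (hP : jac P v = 0) (hP₂ : jac P₂ v = 0) :
    S₂ * jac (P * S₁ + P₂ * S₂) v - (P * S₁ + P₂ * S₂) * jac S₂ v = P * (S₂ * jac S₁ v - S₁ * jac S₂ v) := by
  rw [jac_add_left, jac_mul_left, jac_mul_left, hP, hP₂]
  ring

/-! ### §3 Step 3: the rank-two residue `q(u)·S₁ + q₂(u)·S₂` -/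

/-- **Step 3 (per chart).** For a non-constant `t`-sparse carrier `u`, ANY `q, q₂ : ℂ[X]`, and sparse `S₁, S₂` with `S₂ ≠ 0`:
`|Eset σ (q(u)·S₁ + q₂(u)·S₂)| ≤ 4(t²+t) + 3s₂² + (2s₁s₂t)² + 2`. -/
theorem card_Eset_rank2_le {σ : ℝ} (hσ : σ = 1 ∨ σ = -1) {u S₁ S₂ : Poly2} (q q₂ : Polynomial ℂ) {t s₁ s₂ : ℕ}
    (hu : u.support.card ≤ t) (hS : (S1 u).Nonempty) (hS₂ : S₂ ≠ 0) (h1 : S₁.support.card ≤ s₁) (h2 : S₂.support.card ≤ s₂) :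
    (Eset σ (Polynomial.aeval u q * S₁ + Polynomial.aeval u q₂ * S₂)).card ≤
      4 * (t * t + t) + 3 * (s₂ * s₂) + (2 * s₁ * s₂ * t) * (2 * s₁ * s₂ * t) + 2 := by
  set R := Polynomial.aeval u q * S₁ + Polynomial.aeval u q₂ * S₂ with hR
  set T := S₂ * jac S₁ u - S₁ * jac S₂ u with hT
  have hid : (1 : Poly2) * (S₂ * jac R u - R * jac S₂ u) = Polynomial.aeval u q * T := by
    rw [one_mul, hR, hT]
    exact shift_identity₂ _ _ S₁ S₂ u (jac_aeval_self u q) (jac_aeval_self u q₂)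
  have hsub := Eset_subset_of_shifted hσ hS hS₂ one_ne_zero hid
  have hX : (Xc σ u).card ≤ t * t + t := (card_Xc_le σ u).trans (Nat.add_le_add (Nat.mul_le_mul hu hu) hu)
  have hG : (Eset σ S₂).card ≤ s₂ * s₂ := (card_Eset_le σ S₂).trans (Nat.mul_le_mul h2 h2)
  have hSS : (SpecShift σ u S₂ R).card ≤ 2 * ((t * t + t) + s₂ * s₂ + 1) :=
    (card_SpecShift_le' hσ u S₂ R).trans (by omega)
  have hF : (Eset σ (Polynomial.aeval u q)).card ≤ t * t + t := card_Eset_aeval_le hσ hu q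
  have hTs : T.support.card ≤ 2 * s₁ * s₂ * t := by
    have a := (card_supp_mul_le S₂ (jac S₁ u)).trans (Nat.mul_le_mul h2 ((card_support_jac_le S₁ u).trans (Nat.mul_le_mul h1 hu)))
    have b := (card_supp_mul_le S₁ (jac S₂ u)).trans (Nat.mul_le_mul h1 ((card_support_jac_le S₂ u).trans (Nat.mul_le_mul h2 hu)))
    have c := card_supp_sub_le (S₂ * jac S₁ u) (S₁ * jac S₂ u)
    rw [← hT] at c
    have e1 : s₂ * (s₁ * t) + s₁ * (s₂ * t) = 2 * s₁ * s₂ * t := by ring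
    omega
  have hTE : (Eset σ T).card ≤ (2 * s₁ * s₂ * t) * (2 * s₁ * s₂ * t) := (card_Eset_le σ T).trans (Nat.mul_le_mul hTs hTs)
  have hc := (Finset.card_le_card hsub).trans
    ((Finset.card_union_le _ _).trans (Nat.add_le_add
      ((Finset.card_union_le _ _).trans (Nat.add_le_add (Finset.card_union_le _ _) le_rfl))
      (Finset.card_union_le _ _)))
  omega

/-! ### §4 Step 2: the two-term combination `q(u)·A + r(v)·G` against the carrier `v` -/

/-- **Step 2 (per chart), abstract in the two brackets `A`, `G`.** For `t`-sparse carriers `u, v` (`v` non-constant), ANY `q, r : ℂ[X]`, and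
`A, G` with `≤ t²` monomials, `G ≠ 0`: `|Eset σ (q(u)·A + r(v)·G)| ≤ 7(t²+t) + 3t⁴ + 4t¹⁰ + 3t¹² + 16t²⁴ + 4`.
(In the chain `A = J(u,x)`, `G = J(v,x)` for the third carrier `x`.) -/
theorem card_Eset_rank2E_le {σ : ℝ} (hσ : σ = 1 ∨ σ = -1) {t : ℕ} {u v A G : Poly2} (q r : Polynomial ℂ)
    (hu : u.support.card ≤ t) (hv : v.support.card ≤ t) (hAs : A.support.card ≤ t * t) (hGs : G.support.card ≤ t * t)
    (hG : G ≠ 0) (hSv : (S1 v).Nonempty) :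
    (Eset σ (Polynomial.aeval u q * A + Polynomial.aeval v r * G)).card ≤
      7 * (t * t + t) + 3 * t ^ 4 + 4 * t ^ 10 + 3 * t ^ 12 + 16 * t ^ 24 + 4 := by
  -- the step-2 identity: `1·(G·J(E,v) − E·J(G,v)) = 1·R`
  have hid : (1 : Poly2) * (G * jac (Polynomial.aeval u q * A + Polynomial.aeval v r * G) v -
      (Polynomial.aeval u q * A + Polynomial.aeval v r * G) * jac G v) =
      1 * (Polynomial.aeval u q * (G * jac A v - A * jac G v) +
        Polynomial.aeval u (Polynomial.derivative q) * (G * A * jac u v)) := by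
    rw [one_mul, one_mul]
    exact shift_identity₁ A G (Polynomial.aeval u q) (Polynomial.aeval u (Polynomial.derivative q))
      (Polynomial.aeval v r) v (jac u v) (jac_aeval_self v r) (jac_aeval u v q)
  have hsub := Eset_subset_of_shifted hσ hSv hG one_ne_zero hid
  -- sizes
  have hX : (Xc σ v).card ≤ t * t + t := (card_Xc_le σ v).trans (Nat.add_le_add (Nat.mul_le_mul hv hv) hv)
  have hGE : (Eset σ G).card ≤ t ^ 4 := by
    have := (card_Eset_le σ G).trans (Nat.mul_le_mul hGs hGs)
    have e : t * t * (t * t) = t ^ 4 := by ring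
    omega
  have hSS : (SpecShift σ v G (Polynomial.aeval u q * A + Polynomial.aeval v r * G)).card ≤ 2 * ((t * t + t) + t ^ 4 + 1) :=
    (card_SpecShift_le' hσ v G _).trans (by omega)
  have h1E : (Eset σ (1 : Poly2)).card = 0 := by rw [← C_1, Eset_C, Finset.card_empty]
  have hS₁s : (G * jac A v - A * jac G v).support.card ≤ 2 * t ^ 5 := by
    have a := (card_supp_mul_le G (jac A v)).trans (Nat.mul_le_mul hGs ((card_support_jac_le A v).trans (Nat.mul_le_mul hAs hv)))
    have b := (card_supp_mul_le A (jac G v)).trans (Nat.mul_le_mul hAs ((card_support_jac_le G v).trans (Nat.mul_le_mul hGs hv)))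
    have c := card_supp_sub_le (G * jac A v) (A * jac G v)
    have e : t * t * (t * t * t) = t ^ 5 := by ring
    omega
  have hS₂s : (G * A * jac u v).support.card ≤ t ^ 6 := by
    have a := (card_supp_mul_le (G * A) (jac u v)).trans
      (Nat.mul_le_mul ((card_supp_mul_le G A).trans (Nat.mul_le_mul hGs hAs)) ((card_support_jac_le u v).trans (Nat.mul_le_mul hu hv)))
    have e : t * t * (t * t) * (t * t) = t ^ 6 := by ring
    omega
  -- |Eset R|, both branches
  have hRE : (Eset σ (Polynomial.aeval u q * (G * jac A v - A * jac G v) +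
      Polynomial.aeval u (Polynomial.derivative q) * (G * A * jac u v))).card ≤
      4 * (t * t + t) + 3 * t ^ 12 + 4 * t ^ 10 + 16 * t ^ 24 + 2 := by
    by_cases hS₂0 : G * A * jac u v = 0
    · rw [hS₂0, mul_zero, add_zero]
      have hp := card_Eset_mul_le hσ (Polynomial.aeval u q) (G * jac A v - A * jac G v)
      have ha := card_Eset_aeval_le hσ hu q
      have hb : (Eset σ (G * jac A v - A * jac G v)).card ≤ (2 * t ^ 5) * (2 * t ^ 5) :=
        (card_Eset_le σ _).trans (Nat.mul_le_mul hS₁s hS₁s)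
      have e : (2 * t ^ 5) * (2 * t ^ 5) = 4 * t ^ 10 := by ring
      omega
    · have hSu : (S1 u).Nonempty := by
        have hj : jac u v ≠ 0 := fun h => hS₂0 (by rw [h, mul_zero])
        exact S1_nonempty_of_jac_ne_zero hj
      have h3 := card_Eset_rank2_le hσ q (Polynomial.derivative q) hu hSu hS₂0 hS₁s hS₂s
      have e1 : t ^ 6 * t ^ 6 = t ^ 12 := by ring
      have e2 : (2 * (2 * t ^ 5) * t ^ 6 * t) * (2 * (2 * t ^ 5) * t ^ 6 * t) = 16 * t ^ 24 := by ring
      rw [e1, e2] at h3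
      omega
  have hc := (Finset.card_le_card hsub).trans
    ((Finset.card_union_le _ _).trans (Nat.add_le_add
      ((Finset.card_union_le _ _).trans (Nat.add_le_add (Finset.card_union_le _ _) le_rfl))
      (Finset.card_union_le _ _)))
  omega

/-! ### §5 Two carriers, then three: the per-chart count -/

/-- **Two carriers (per chart).** `|Eset σ (f(u) + g(v))| ≤ 4(t²+t) + t⁴ + 2` for `t`-sparse `u, v` and any `f, g : ℂ[X]`. -/
theorem card_Eset_sep2_le {σ : ℝ} (hσ : σ = 1 ∨ σ = -1) {t : ℕ} {u v : Poly2} (hu : u.support.card ≤ t) (hv : v.support.card ≤ t)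
    (f g : Polynomial ℂ) : (Eset σ (Polynomial.aeval u f + Polynomial.aeval v g)).card ≤ 4 * (t * t + t) + t ^ 4 + 2 := by
  by_cases hSv : (S1 v).Nonempty
  · have hid : (1 : Poly2) * jac (Polynomial.aeval u f + Polynomial.aeval v g) v =
        Polynomial.aeval u (Polynomial.derivative f) * jac u v := by
      rw [one_mul, jac_add_left, jac_aeval, jac_aeval_self, add_zero]
    have hsub := Eset_subset_of_axial hσ hSv one_ne_zero hid
    have hX : (Xc σ v).card ≤ t * t + t := (card_Xc_le σ v).trans (Nat.add_le_add (Nat.mul_le_mul hv hv) hv)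
    have hSp := card_Spec_le hσ v (Polynomial.aeval u f + Polynomial.aeval v g)
    have hF := card_Eset_aeval_le hσ hu (Polynomial.derivative f)
    have hJ := card_Eset_jac_le σ hu hv
    have hc := (Finset.card_le_card hsub).trans
      ((Finset.card_union_le _ _).trans (Nat.add_le_add (Finset.card_union_le _ _) (Finset.card_union_le _ _)))
    omega
  · -- `v` constant: `g(v)` is a constant absorbed into `f`
    obtain ⟨c, hc⟩ : ∃ c : ℂ, v = C c := ⟨_, eq_C_of_S1_empty hSv⟩
    have hN : Polynomial.aeval u f + Polynomial.aeval v g = Polynomial.aeval u (f + Polynomial.C (g.eval c)) := by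
      rw [map_add, Polynomial.aeval_C, MvPolynomial.algebraMap_eq, hc, aeval_C_eq]
    rw [hN]
    have := card_Eset_aeval_le hσ hu (f + Polynomial.C (g.eval c))
    nlinarith [Nat.zero_le (t ^ 4), Nat.zero_le (t * t + t)]

/-- ★ **Three carriers (per chart):** `|Eset σ (f₀(w₀) + f₁(w₁) + f₂(w₂))| ≤ 16t²⁴ + 3t¹² + 4t¹⁰ + 3t⁴ + 10(t²+t) + 6`. -/
theorem card_Eset_separated_le {σ : ℝ} (hσ : σ = 1 ∨ σ = -1) {t : ℕ} (w : Fin 3 → Poly2)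
    (hw : ∀ i, (w i).support.card ≤ t) (f₀ f₁ f₂ : Polynomial ℂ) :
    (Eset σ (Polynomial.aeval (w 0) f₀ + Polynomial.aeval (w 1) f₁ + Polynomial.aeval (w 2) f₂)).card ≤
      16 * t ^ 24 + 3 * t ^ 12 + 4 * t ^ 10 + 3 * t ^ 4 + 10 * (t * t + t) + 6 := by
  by_cases hS2 : (S1 (w 2)).Nonempty
  · -- Step 1: axial transfer against `w 2`; `J(N, w 2) = E`
    have hid : (1 : Poly2) * jac (Polynomial.aeval (w 0) f₀ + Polynomial.aeval (w 1) f₁ + Polynomial.aeval (w 2) f₂) (w 2) =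
        1 * (Polynomial.aeval (w 0) (Polynomial.derivative f₀) * jac (w 0) (w 2) +
          Polynomial.aeval (w 1) (Polynomial.derivative f₁) * jac (w 1) (w 2)) := by
      rw [one_mul, one_mul, jac_add_left, jac_add_left, jac_aeval, jac_aeval, jac_aeval_self, add_zero]
    have hsub := Eset_subset_of_axial hσ hS2 one_ne_zero hid
    have hX : (Xc σ (w 2)).card ≤ t * t + t :=
      (card_Xc_le σ (w 2)).trans (Nat.add_le_add (Nat.mul_le_mul (hw 2) (hw 2)) (hw 2))
    have hSp := card_Spec_le hσ (w 2) (Polynomial.aeval (w 0) f₀ + Polynomial.aeval (w 1) f₁ + Polynomial.aeval (w 2) f₂)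
    have h1E : (Eset σ (1 : Poly2)).card = 0 := by rw [← C_1, Eset_C, Finset.card_empty]
    -- |Eset E|: the product branch `j₁₂ = 0` and the main branch
    have hEE : (Eset σ (Polynomial.aeval (w 0) (Polynomial.derivative f₀) * jac (w 0) (w 2) +
        Polynomial.aeval (w 1) (Polynomial.derivative f₁) * jac (w 1) (w 2))).card ≤
        7 * (t * t + t) + 3 * t ^ 4 + 4 * t ^ 10 + 3 * t ^ 12 + 16 * t ^ 24 + 4 := by
      by_cases h12 : jac (w 1) (w 2) = 0
      · rw [h12, mul_zero, add_zero]
        have hp := card_Eset_mul_le hσ (Polynomial.aeval (w 0) (Polynomial.derivative f₀)) (jac (w 0) (w 2))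
        have ha := card_Eset_aeval_le hσ (hw 0) (Polynomial.derivative f₀)
        have hb := card_Eset_jac_le σ (hw 0) (hw 2)
        nlinarith [Nat.zero_le (t ^ 24), Nat.zero_le (t ^ 12), Nat.zero_le (t ^ 10), Nat.zero_le (t ^ 4), Nat.zero_le (t * t + t)]
      · exact card_Eset_rank2E_le hσ (Polynomial.derivative f₀) (Polynomial.derivative f₁) (hw 0) (hw 1)
          ((card_support_jac_le (w 0) (w 2)).trans (Nat.mul_le_mul (hw 0) (hw 2)))
          ((card_support_jac_le (w 1) (w 2)).trans (Nat.mul_le_mul (hw 1) (hw 2))) h12 (S1_nonempty_of_jac_ne_zero h12)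
    have hc := (Finset.card_le_card hsub).trans
      ((Finset.card_union_le _ _).trans (Nat.add_le_add (Finset.card_union_le _ _) (Finset.card_union_le _ _)))
    omega
  · -- `w 2` constant: `f₂(w₂)` is a constant absorbed into `f₁`; two-carrier chain
    obtain ⟨c, hc⟩ : ∃ c : ℂ, w 2 = C c := ⟨_, eq_C_of_S1_empty hS2⟩
    have hN' : Polynomial.aeval (w 0) f₀ + Polynomial.aeval (w 1) f₁ + Polynomial.aeval (w 2) f₂ =
        Polynomial.aeval (w 0) f₀ + Polynomial.aeval (w 1) (f₁ + Polynomial.C (f₂.eval c)) := by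
      rw [map_add, Polynomial.aeval_C, MvPolynomial.algebraMap_eq, hc, aeval_C_eq, add_assoc]
    rw [hN']
    have := card_Eset_sep2_le hσ (hw 0) (hw 1) f₀ (f₁ + Polynomial.C (f₂.eval c))
    nlinarith [Nat.zero_le (t ^ 24), Nat.zero_le (t ^ 12), Nat.zero_le (t ^ 10), Nat.zero_le (t ^ 4), Nat.zero_le (t * t + t)]

/-! ### §6 The headline, the law -/

/-- ★★ **T1-A″ SETTLED (uniform).** For `t`-sparse carriers `w₀, w₁, w₂ ∈ ℂ[x,y]` and ANY univariate `f₀, f₁, f₂ ∈ ℂ[X]`: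
`nv (f₀(w₀) + f₁(w₁) + f₂(w₂)) ≤ 2·(16t²⁴ + 3t¹² + 4t¹⁰ + 3t⁴ + 10(t²+t) + 6) + 4` — no hypothesis on the `fᵢ`. -/
theorem separatedAffine_nv_le {t : ℕ} (w : Fin 3 → Poly2) (hw : ∀ i, (w i).support.card ≤ t) (f₀ f₁ f₂ : Polynomial ℂ) :
    nv (Polynomial.aeval (w 0) f₀ + Polynomial.aeval (w 1) f₁ + Polynomial.aeval (w 2) f₂) ≤
      2 * (16 * t ^ 24 + 3 * t ^ 12 + 4 * t ^ 10 + 3 * t ^ 4 + 10 * (t * t + t) + 6) + 4 := by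
  have h1 := card_Eset_separated_le (σ := 1) (Or.inl rfl) w hw f₀ f₁ f₂
  have h2 := card_Eset_separated_le (σ := -1) (Or.inr rfl) w hw f₀ f₁ f₂
  have h := nv_le (Polynomial.aeval (w 0) f₀ + Polynomial.aeval (w 1) f₁ + Polynomial.aeval (w 2) f₂)
  omega

/-- The ADDITIVELY SEPARATED affine law (crit-8 g5 C3 verbatim): `nv (f₀(w₀) + f₁(w₁) + f₂(w₂)) ≤ (deg f₀ + deg f₁ + deg f₂ + 2)^c (t+2)^c` for some
absolute `c`.  PROVED below (`separatedAffineLaw`, `c = 31`) — in fact uniformly in the `fᵢ` (`separatedAffine_nv_le`). -/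
def SeparatedAffineLaw : Prop :=
  ∃ c : ℕ, ∀ (t : ℕ) (f₀ f₁ f₂ : Polynomial ℂ) (w : Fin 3 → Poly2), (∀ i, (w i).support.card ≤ t) →
    nv (Polynomial.aeval (w 0) f₀ + Polynomial.aeval (w 1) f₁ + Polynomial.aeval (w 2) f₂) ≤
      (f₀.natDegree + f₁.natDegree + f₂.natDegree + 2) ^ c * (t + 2) ^ c

/-- Arithmetic: the uniform bound is `≤ (t+2)^31` (every monomial `≤ (t+2)^24`, coefficients sum to `108 ≤ 2^7 ≤ (t+2)^7`). [folklore] -/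
theorem separated_arith (t : ℕ) :
    2 * (16 * t ^ 24 + 3 * t ^ 12 + 4 * t ^ 10 + 3 * t ^ 4 + 10 * (t * t + t) + 6) + 4 ≤ (t + 2) ^ 31 := by
  have ht : t ≤ t + 2 := Nat.le_add_right t 2
  have h1 : 1 ≤ t + 2 := by omega
  have p24 : t ^ 24 ≤ (t + 2) ^ 24 := Nat.pow_le_pow_left ht 24
  have p12 : t ^ 12 ≤ (t + 2) ^ 24 := (Nat.pow_le_pow_left ht 12).trans (Nat.pow_le_pow_right h1 (by norm_num))
  have p10 : t ^ 10 ≤ (t + 2) ^ 24 := (Nat.pow_le_pow_left ht 10).trans (Nat.pow_le_pow_right h1 (by norm_num))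
  have p4 : t ^ 4 ≤ (t + 2) ^ 24 := (Nat.pow_le_pow_left ht 4).trans (Nat.pow_le_pow_right h1 (by norm_num))
  have p2 : t * t ≤ (t + 2) ^ 24 := by
    have : t ^ 2 ≤ (t + 2) ^ 24 := (Nat.pow_le_pow_left ht 2).trans (Nat.pow_le_pow_right h1 (by norm_num))
    rwa [pow_two] at this
  have p1 : t ≤ (t + 2) ^ 24 := by
    have : t ^ 1 ≤ (t + 2) ^ 24 := (Nat.pow_le_pow_left ht 1).trans (Nat.pow_le_pow_right h1 (by norm_num))
    rwa [pow_one] at this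
  have p0 : 1 ≤ (t + 2) ^ 24 := Nat.one_le_pow _ _ h1
  have hsum : 2 * (16 * t ^ 24 + 3 * t ^ 12 + 4 * t ^ 10 + 3 * t ^ 4 + 10 * (t * t + t) + 6) + 4 ≤ 108 * (t + 2) ^ 24 := by
    omega
  have h7 : 108 ≤ (t + 2) ^ 7 := by
    calc 108 ≤ 2 ^ 7 := by norm_num
      _ ≤ (t + 2) ^ 7 := Nat.pow_le_pow_left (by omega) 7
  calc _ ≤ 108 * (t + 2) ^ 24 := hsum
    _ ≤ (t + 2) ^ 7 * (t + 2) ^ 24 := Nat.mul_le_mul_right _ h7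
    _ = (t + 2) ^ 31 := by rw [← pow_add]

/-- ★ **`SeparatedAffineLaw` holds** (`c = 31`; the uniform bound dominates). -/
theorem separatedAffineLaw : SeparatedAffineLaw := by
  refine ⟨31, fun t f₀ f₁ f₂ w hw => (separatedAffine_nv_le w hw f₀ f₁ f₂).trans ((separated_arith t).trans ?_)⟩
  exact Nat.le_mul_of_pos_left _ (pow_pos (by omega) 31)

/-- The same bound in the rung's own currency `nv (MvPolynomial.aeval w P)` for the separated outer polynomial
`P = f₀(X₀) + f₁(X₁) + f₂(X₂) ∈ ℂ[X₀,X₁,X₂]` (hypothesis-free corollary; `Polynomial.aeval_algHom_apply`, `MvPolynomial.aeval_X`). -/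
theorem separatedAffine_nv_le_aeval {t : ℕ} (w : Fin 3 → Poly2) (hw : ∀ i, (w i).support.card ≤ t) (f₀ f₁ f₂ : Polynomial ℂ) :
    nv (MvPolynomial.aeval w (Polynomial.aeval (X 0 : Poly3) f₀ + Polynomial.aeval (X 1 : Poly3) f₁ + Polynomial.aeval (X 2 : Poly3) f₂)) ≤
      2 * (16 * t ^ 24 + 3 * t ^ 12 + 4 * t ^ 10 + 3 * t ^ 4 + 10 * (t * t + t) + 6) + 4 := by
  rw [map_add, map_add, ← Polynomial.aeval_algHom_apply, ← Polynomial.aeval_algHom_apply, ← Polynomial.aeval_algHom_apply,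
    MvPolynomial.aeval_X, MvPolynomial.aeval_X, MvPolynomial.aeval_X]
  exact separatedAffine_nv_le w hw f₀ f₁ f₂

end Summit.ValiantsHypothesis.ValiantsHypothesis.Theorems.TwoProducts.RankTwoJacobian

end
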